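import Summits.Ventures.LatticeQCDFlow.TrivializingMaps.ZeroPinching
import Literature.MathematicalPhysics.QuantumFieldTheory.Luscher2010.TrivializingMaps
import Literature.MathematicalPhysics.QuantumFieldTheory.WilsonEnergyConvexity

/-!
# COROLLARY N for the Wilson action: Fisher zeros of `∫ D[U] e^{-s S_W(U)}` pinch every bulk
transition of the limiting free energy, for every compact gauge group

HONEST FRAMING: exact (Metropolis-corrected) sampling algorithms for lattice gauge theory;
figures of merit are autocorrelation/cost numbers at stated couplings and volumes; no
continuum-physics claim. This file instantiates `ZeroPinching` (COROLLARY N of THEORY-1 §13.4)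
on the venture's own objects: the torus `Λ = (ℤ/Lℤ)^d`, configurations `GaugeConfig d L G`
(`Edge d L → G`) of a compact group `G`, a continuous matrix representation `ρ : G →* M_N(ℂ)`,
the Wilson action `S_W(U) = ∑_p Re tr(1 - ρ(U_p))` (`wilsonAction ρ`), Lüscher's trivial theory
`D[U] = trivialMeasure G d L` (product of Haar probability measures, [Luscher2010Trivializing]
eq. (2.1)) and Wave 0's partition function `Z_{Λ,β} = partitionFunction ρ β = ∫ e^{-β S_W} D[U]`.
The complexified partition function is written OUT, `Z_L(s) := ∫ U, exp(-s · S_W(U)) D[U]`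
(`s ∈ ℂ`); along Lüscher's Wilson flow `S = tβ S_W` it is the function `Z` of THEOREM F
(`Ċ_t Z = Z′`, `FisherObstruction`) at `s = tβ`. Nothing is defined in this file.

* `abs_wilsonAction_le`: `0 ≤ S_W(U) ≤ 2N · #plaquettes(Λ)` — the observable `-S_W` is extensive
  with the VOLUME-UNIFORM constant `A = 2N` per plaquette (`|Re tr ρ(g)| ≤ N` on a compact group).
* `complexMGF_neg_wilsonAction`, `mgf_neg_wilsonAction`, `wilsonZ_ofReal`: `Z_L` is the complex
  MGF of `-S_W` under `D[U]`, and `Z_L(β) = Z_{Λ,β} > 0` for real `β` (no real Fisher zeros);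
  `differentiable_wilsonZ`: `Z_L` is entire.
* **`wilson_fisherZeros_pinch`**: for ANY volumes `L k ≥ 1` (`d ≥ 2`): if the free energy per
  plaquette `log Z_{Λ_k,β} / #plaquettes(Λ_k)` converges to `p(β)` for real `β` near `β_c` and
  `p` is NOT real-analytic at `β_c`, then for every `r > 0` and all large `k`, `Z_{L_k}` has a
  complex zero `s` with `|s - β_c| < r`.
* **`wilson_no_flowConstant`**: consequently, for every `r > 0` and all large `k` there is NO
  function `C` continuous on `B(β_c, r) ⊆ ℂ` with `Z_{L_k}′ = C · Z_{L_k}` there — no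
  trivializing flow of the Wilson theory on `Λ_k` has a flow constant (hence a flow action)
  continuous in the complexified flow parameter on a fixed neighbourhood of a bulk transition,
  uniformly in the volume.
* `wilson_pressure_analyticOnNhd`: conversely, if `Z_{L_k}` is zero-free on `B(β_c, R)` for
  infinitely many `k`, the limiting free energy is real-analytic on `(β_c - R, β_c + R)`.

Per-plaquette and per-site normalisations differ by the constant `d(d-1)/2` and have the same
analyticity. WHAT IS NOT PROVED here (paper / literature only): the existence of the limit `p`
and its non-analyticity for a concrete `(G, ρ, d)` — proved in print for first-order bulk
transitions of nonlinear plaquette actions and gauge-Potts models, numerical for compact `U(1)`,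
`d = 4`; for `SU(2)`, `SU(3)`, `d = 4` no bulk transition is expected and the theorem is silent
(THEORY-1 §21.2). References: M. Lüscher, Commun. Math. Phys. 293 (2010) 899, §2.1, §4
[bib `Luscher2010Trivializing`]; S. Friedli, Y. Velenik, *Statistical Mechanics of Lattice
Systems* (CUP 2017), Thm 3.42 [bib `FriedliVelenik2017`]; THEORY-1.md §13.4, §21.
-/

open MeasureTheory ProbabilityTheory Filter Topology Complex Set Metric
open Literature.MathematicalPhysics.QuantumFieldTheory
open Literature.MathematicalPhysics.QuantumFieldTheory.Luscher2010
open Summit.Ventures.LatticeQCDFlow.TrivializingMaps.ZeroPinching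

namespace Summit.Ventures.LatticeQCDFlow.TrivializingMaps.WilsonPinching

variable {d L N : ℕ} {G : Type*} [Group G] [TopologicalSpace G] [IsTopologicalGroup G]
  [CompactSpace G] [MeasurableSpace G] [BorelSpace G] (ρ : G →* Matrix (Fin N) (Fin N) ℂ)

/-! ### The Wilson action is a bounded extensive observable -/

section Action

omit [MeasurableSpace G] [BorelSpace G] in
/-- `0 ≤ S_W(U)`: each plaquette term `N - Re tr ρ(U_p)` is non-negative (`|Re tr ρ(g)| ≤ N`). -/
theorem wilsonAction_nonneg [NeZero L] (hρ : Continuous ρ) (U : GaugeConfig d L G) :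
    0 ≤ wilsonAction ρ U := by
  rw [WilsonRP.wilsonAction_eq ρ U]
  have h : ∑ p, WilsonRP.plaqRe ρ U p ≤ ∑ _p : Plaquette d L, (N : ℝ) :=
    Finset.sum_le_sum fun p _ => (le_abs_self _).trans (WilsonRP.abs_plaqRe_le ρ hρ U p)
  rw [Finset.sum_const, Finset.card_univ, nsmul_eq_mul] at h
  linarith

omit [MeasurableSpace G] [BorelSpace G] in
/-- `S_W(U) ≤ 2N · #plaquettes`. -/
theorem wilsonAction_le [NeZero L] (hρ : Continuous ρ) (U : GaugeConfig d L G) :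
    wilsonAction ρ U ≤ 2 * N * Fintype.card (Plaquette d L) := by
  rw [WilsonRP.wilsonAction_eq ρ U]
  have h : -∑ p, WilsonRP.plaqRe ρ U p ≤ ∑ _p : Plaquette d L, (N : ℝ) := by
    rw [← Finset.sum_neg_distrib]
    exact Finset.sum_le_sum fun p _ => (neg_le_abs _).trans (WilsonRP.abs_plaqRe_le ρ hρ U p)
  rw [Finset.sum_const, Finset.card_univ, nsmul_eq_mul] at h
  linarith

omit [MeasurableSpace G] [BorelSpace G] in
/-- **Volume-uniform extensivity**: `|S_W(U)| ≤ 2N · #plaquettes(Λ)` for every configuration,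
every `L` and every compact `G` (the constant `A = 2N` of COROLLARY N, per plaquette). -/
theorem abs_wilsonAction_le [NeZero L] (hρ : Continuous ρ) (U : GaugeConfig d L G) :
    |wilsonAction ρ U| ≤ 2 * N * Fintype.card (Plaquette d L) := by
  have h0 := wilsonAction_nonneg ρ hρ U
  have h1 : (0 : ℝ) ≤ 2 * N * Fintype.card (Plaquette d L) := by positivity
  exact abs_le.2 ⟨by linarith, wilsonAction_le ρ hρ U⟩

/-- A torus of dimension `d ≥ 2` and side `L ≥ 1` has at least one plaquette (so the "volume"
`#plaquettes ≥ 1`). -/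
theorem one_le_card_plaquette (hd : 2 ≤ d) [NeZero L] : 1 ≤ Fintype.card (Plaquette d L) :=
  Fintype.card_pos_iff.2
    ⟨(fun _ => 0, ⟨(⟨0, by omega⟩, ⟨1, by omega⟩), Fin.mk_lt_mk.2 Nat.zero_lt_one⟩)⟩

end Action

/-! ### The complexified Wilson partition function `Z_L(s) = ∫ e^{-s S_W} D[U]` -/

section PartitionFunction

variable [NeZero L]

/-- `Z_L(s) = complexMGF (-S_W) D[U] s`: Lüscher's complexified partition function is the complex
moment generating function of the observable `-S_W` under the trivial theory. -/
theorem complexMGF_neg_wilsonAction (s : ℂ) :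
    complexMGF (fun U => -wilsonAction ρ U) (trivialMeasure G d L) s =
      ∫ U, cexp (-(s * (wilsonAction ρ U : ℂ))) ∂(trivialMeasure G d L) := by
  simp only [complexMGF, Complex.ofReal_neg, mul_neg]

/-- `mgf (-S_W) D[U] β = Z_{Λ,β}`: at real coupling the MGF is Wave 0's partition function. -/
theorem mgf_neg_wilsonAction (hρ : Continuous ρ) (β : ℝ) :
    mgf (fun U => -wilsonAction ρ U) (trivialMeasure G d L) β =
      (partitionFunction (d := d) (L := L) ρ β).toReal := by
  rw [partitionFunction_toReal_eq_integral ρ hρ β]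
  simp only [mgf, trivialMeasure, mul_neg, neg_mul]

/-- `Z_{Λ,β} > 0` (as a real number) for every real `β`. -/
theorem partitionFunction_toReal_pos (hρ : Continuous ρ) (β : ℝ) :
    0 < (partitionFunction (d := d) (L := L) ρ β).toReal := by
  rw [partitionFunction_toReal_eq_integral ρ hρ β]
  exact integral_exp_neg_mul_wilsonAction_pos ρ hρ β

/-- **Real couplings carry no Fisher zeros**: `Z_L(β) = Z_{Λ,β} > 0` for real `β`. -/
theorem wilsonZ_ofReal (hρ : Continuous ρ) (β : ℝ) :
    ∫ U, cexp (-((β : ℂ) * (wilsonAction ρ U : ℂ))) ∂(trivialMeasure G d L) =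
      (((partitionFunction (d := d) (L := L) ρ β).toReal : ℝ) : ℂ) := by
  rw [← complexMGF_neg_wilsonAction ρ (β : ℂ), complexMGF_ofReal,
    mgf_neg_wilsonAction ρ hρ β]

/-- **`Z_L` is entire** (a bounded observable on a probability space). -/
theorem differentiable_wilsonZ (hρ : Continuous ρ) :
    Differentiable ℂ fun s : ℂ =>
      ∫ U, cexp (-(s * (wilsonAction ρ U : ℂ))) ∂(trivialMeasure G d L) := by
  haveI : IsProbabilityMeasure (trivialMeasure G d L) := by unfold trivialMeasure; infer_instance
  have h := differentiable_complexMGF_of_abs_le (μ := trivialMeasure G d L)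
    (X := fun U => -wilsonAction ρ U) (b := 2 * N * Fintype.card (Plaquette d L))
    (WilsonRP.measurable_wilsonAction ρ hρ).neg.aemeasurable
    (ae_of_all _ fun U => by rw [abs_neg]; exact abs_wilsonAction_le ρ hρ U)
  have e : complexMGF (fun U => -wilsonAction ρ U) (trivialMeasure G d L) =
      fun s => ∫ U, cexp (-(s * (wilsonAction ρ U : ℂ))) ∂(trivialMeasure G d L) :=
    funext (complexMGF_neg_wilsonAction ρ)
  rwa [e] at h

end PartitionFunction

/-! ### COROLLARY N for the Wilson theory along any sequence of volumes -/

section CorollaryN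

variable (L : ℕ → ℕ) [∀ k, NeZero (L k)] {βc R : ℝ} {p : ℝ → ℝ}

/-- **Fisher zeros pinch a bulk transition of the Wilson theory.** Let `G` be a compact group,
`ρ` a continuous `N`-dimensional representation, `d ≥ 2`, and `Λ_k = (ℤ/L_kℤ)^d` any volumes.
If the free energy per plaquette converges, `log Z_{Λ_k,β} / #plaquettes(Λ_k) → p(β)` for real
`|β - β_c| < R`, and `p` is NOT real-analytic at `β_c`, then for every `r > 0` and all large `k`
the complexified partition function `Z_{L_k}(s) = ∫ e^{-s S_W} D[U]` vanishes at some
`s ∈ B(β_c, r)`. -/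
theorem wilson_fisherZeros_pinch (hρ : Continuous ρ) (hd : 2 ≤ d) (hR : 0 < R)
    (hp : ∀ β : ℝ, |β - βc| < R → Tendsto (fun k =>
      Real.log (partitionFunction (d := d) (L := L k) ρ β).toReal /
        (Fintype.card (Plaquette d (L k)) : ℝ)) atTop (𝓝 (p β)))
    (hna : ¬ AnalyticAt ℝ p βc) {r : ℝ} (hr : 0 < r) :
    ∀ᶠ k in atTop, ∃ s ∈ ball (βc : ℂ) r,
      ∫ U, cexp (-(s * (wilsonAction ρ U : ℂ))) ∂(trivialMeasure G d (L k)) = 0 := by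
  haveI : ∀ k, IsProbabilityMeasure (trivialMeasure G d (L k)) := fun k => by
    unfold trivialMeasure; infer_instance
  have h := fisherZeros_pinch_of_not_analyticAt (Ω := fun k => GaugeConfig d (L k) G)
    (ν := fun k => trivialMeasure G d (L k)) (X := fun k U => -wilsonAction ρ U)
    (V := fun k => (Fintype.card (Plaquette d (L k)) : ℝ)) (A := 2 * N) (c := βc) (R := R)
    (p := p)
    (fun k => (WilsonRP.measurable_wilsonAction ρ hρ).neg.aemeasurable)
    (fun k => by exact_mod_cast one_le_card_plaquette hd)
    (by positivity)
    (fun k => ae_of_all _ fun U => by rw [abs_neg]; exact abs_wilsonAction_le ρ hρ U)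
    (fun β hβ => by simpa only [mgf_neg_wilsonAction ρ hρ] using hp β hβ)
    hna hR hr
  filter_upwards [h] with k hk
  obtain ⟨s, hs, hZ⟩ := hk
  exact ⟨s, hs, by rwa [complexMGF_neg_wilsonAction] at hZ⟩

/-- **No volume-uniform flow constant through a bulk transition of the Wilson theory.** Under the
hypotheses of `wilson_fisherZeros_pinch`: for every `r > 0` and all large `k` there is NO
function `C : ℂ → ℂ` continuous on `B(β_c, r)` with `Z_{L_k}′(s) = C(s) · Z_{L_k}(s)` on
`B(β_c, r)` — Lüscher's flow-constant identity (THEOREM F,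
`Fisher.no_continuous_flowConstant_at_zero`) has no volume-uniform continuous solution on any
fixed complex neighbourhood of the transition. -/
theorem wilson_no_flowConstant (hρ : Continuous ρ) (hd : 2 ≤ d) (hR : 0 < R)
    (hp : ∀ β : ℝ, |β - βc| < R → Tendsto (fun k =>
      Real.log (partitionFunction (d := d) (L := L k) ρ β).toReal /
        (Fintype.card (Plaquette d (L k)) : ℝ)) atTop (𝓝 (p β)))
    (hna : ¬ AnalyticAt ℝ p βc) {r : ℝ} (hr : 0 < r) :
    ∀ᶠ k in atTop, ¬ ∃ C : ℂ → ℂ, ContinuousOn C (ball (βc : ℂ) r) ∧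
      ∀ s ∈ ball (βc : ℂ) r,
        deriv (fun z => ∫ U, cexp (-(z * (wilsonAction ρ U : ℂ))) ∂(trivialMeasure G d (L k)))
            s = C s * ∫ U, cexp (-(s * (wilsonAction ρ U : ℂ))) ∂(trivialMeasure G d (L k)) := by
  haveI : ∀ k, IsProbabilityMeasure (trivialMeasure G d (L k)) := fun k => by
    unfold trivialMeasure; infer_instance
  have h := no_flowConstant_eventually_of_not_analyticAt (Ω := fun k => GaugeConfig d (L k) G)
    (ν := fun k => trivialMeasure G d (L k)) (X := fun k U => -wilsonAction ρ U)
    (V := fun k => (Fintype.card (Plaquette d (L k)) : ℝ)) (A := 2 * N) (c := βc) (R := R)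
    (p := p)
    (fun k => (WilsonRP.measurable_wilsonAction ρ hρ).neg.aemeasurable)
    (fun k => by exact_mod_cast one_le_card_plaquette hd)
    (by positivity)
    (fun k => ae_of_all _ fun U => by rw [abs_neg]; exact abs_wilsonAction_le ρ hρ U)
    (fun β hβ => by simpa only [mgf_neg_wilsonAction ρ hρ] using hp β hβ)
    hna hR hr
  filter_upwards [h] with k hk
  have e : complexMGF (fun U => -wilsonAction ρ U) (trivialMeasure G d (L k)) =
      fun z => ∫ U, cexp (-(z * (wilsonAction ρ U : ℂ))) ∂(trivialMeasure G d (L k)) :=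
    funext (complexMGF_neg_wilsonAction ρ)
  simpa only [e] using hk

/-- **Lee–Yang form for the Wilson theory.** If `Z_{L_k}` is zero-free on the complex disc
`B(β_c, R)` for infinitely many `k` and the free energy per plaquette converges to `p` for real
`|β - β_c| < R`, then `p` is real-analytic on the whole interval `(β_c - R, β_c + R)`: a
zero-free region of couplings contains no bulk transition. -/
theorem wilson_pressure_analyticOnNhd (hρ : Continuous ρ) (hd : 2 ≤ d)
    (hzf : ∃ᶠ k in atTop, ∀ s ∈ ball (βc : ℂ) R,
      ∫ U, cexp (-(s * (wilsonAction ρ U : ℂ))) ∂(trivialMeasure G d (L k)) ≠ 0)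
    (hp : ∀ β : ℝ, |β - βc| < R → Tendsto (fun k =>
      Real.log (partitionFunction (d := d) (L := L k) ρ β).toReal /
        (Fintype.card (Plaquette d (L k)) : ℝ)) atTop (𝓝 (p β))) :
    AnalyticOnNhd ℝ p (Ioo (βc - R) (βc + R)) := by
  haveI : ∀ k, IsProbabilityMeasure (trivialMeasure G d (L k)) := fun k => by
    unfold trivialMeasure; infer_instance
  refine pressure_analyticOnNhd_of_frequently_zeroFree (Ω := fun k => GaugeConfig d (L k) G)
    (ν := fun k => trivialMeasure G d (L k)) (X := fun k U => -wilsonAction ρ U)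
    (V := fun k => (Fintype.card (Plaquette d (L k)) : ℝ)) (A := 2 * N) (c := βc) (R := R)
    (p := p)
    (fun k => (WilsonRP.measurable_wilsonAction ρ hρ).neg.aemeasurable)
    (fun k => by exact_mod_cast one_le_card_plaquette hd)
    (by positivity)
    (fun k => ae_of_all _ fun U => by rw [abs_neg]; exact abs_wilsonAction_le ρ hρ U)
    (hzf.mono fun k hk s hs => by rw [complexMGF_neg_wilsonAction]; exact hk s hs)
    (fun β hβ => by simpa only [mgf_neg_wilsonAction ρ hρ] using hp β hβ)

end CorollaryN

end Summit.Ventures.LatticeQCDFlow.TrivializingMaps.WilsonPinching
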